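import Summits.RiemannHypothesis.RiemannHypothesis.Theorems.IntegerScrewCensusFastRows

/-!
# Route `IntegerScrew` — fast kernel arithmetic for manifest-certificate checks (4a): the composite step in complex norm

The rows of `IntegerScrewCensusFastRows` store `ẑ ≈ e^{i t log m}` as offset fixed-point pairs; a composite node is the
rounded product of two earlier pairs (`cmulRe/cmulIm`).  This file isolates the ERROR PROPAGATION of that step in complex
norm: `zOf X Y = (oval X + i·oval Y)/2^52`, and `step_err`: if `‖ẑ₁ − z‖ ≤ ε₁`, `‖ẑ₂ − w‖ ≤ ε₂` with `‖z‖ = ‖w‖ = 1`,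
`ε₁, ε₂ ≤ 1`, then the rounded product is within `ε₁ + ε₂ + ε₁ε₂ + 2/2^52` of `z·w`.  (The componentwise version would
lose a factor `2` per level of the factor recursion; the complex-norm version gives the linear law `(2·depth − 1)·U`.)
Pure arithmetic; RH-free and ζ-free; nothing here bears on the truth of RH.
-/

set_option linter.dupNamespace false
set_option autoImplicit false

namespace Summit.RiemannHypothesis.RiemannHypothesis.Theorems.IntegerScrew.Manifest.Fast

open Finset

/-- The complex number stored by an offset pair: `(oval X + i·oval Y)/2^52`. -/
noncomputable def zOf (X Y : ℕ) : ℂ := ⟨(oval X : ℝ) / SCL, (oval Y : ℝ) / SCL⟩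

/-- `‖⟨a, b⟩‖ ≤ |a| + |b|`. -/
theorem norm_mk_le (a b : ℝ) : ‖(⟨a, b⟩ : ℂ)‖ ≤ |a| + |b| := by
  have h := Complex.norm_le_abs_re_add_abs_im (⟨a, b⟩ : ℂ)
  simpa using h

/-- A component is bounded by the norm: `|oval X| ≤ ‖zOf X Y‖·2^52`, `|oval Y| ≤ ‖zOf X Y‖·2^52`. -/
theorem abs_oval_le_of_zOf (X Y : ℕ) :
    |(oval X : ℝ)| ≤ ‖zOf X Y‖ * SCL ∧ |(oval Y : ℝ)| ≤ ‖zOf X Y‖ * SCL := by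
  have hS : (0 : ℝ) < SCL := by norm_num [SCL]
  have h1 : |(oval X : ℝ) / SCL| ≤ ‖zOf X Y‖ := Complex.abs_re_le_norm (zOf X Y)
  have h2 : |(oval Y : ℝ) / SCL| ≤ ‖zOf X Y‖ := Complex.abs_im_le_norm (zOf X Y)
  rw [abs_div, abs_of_pos hS, div_le_iff₀ hS] at h1 h2
  exact ⟨h1, h2⟩

/-- **The composite step.**  Rounded fixed-point product of two approximate unit complex numbers. -/
theorem step_err {X1 X2 Y1 Y2 : ℕ} {z w : ℂ} {ε1 ε2 : ℝ}
    (h1 : ‖zOf X1 X2 - z‖ ≤ ε1) (h2 : ‖zOf Y1 Y2 - w‖ ≤ ε2) (hz : ‖z‖ = 1) (hw : ‖w‖ = 1)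
    (he1 : ε1 ≤ 1) (he2 : ε2 ≤ 1) :
    ‖zOf (cmulRe X1 X2 Y1 Y2) (cmulIm X1 X2 Y1 Y2) - z * w‖ ≤ ε1 + ε2 + ε1 * ε2 + 2 / SCL := by
  have hS : (0 : ℝ) < SCL := by norm_num [SCL]
  have hSv : (SCL : ℝ) = 2 ^ 52 := by norm_num [SCL]
  -- sizes of the stored integers
  have hn1 : ‖zOf X1 X2‖ ≤ 2 := by
    have := norm_sub_norm_le (zOf X1 X2) z; linarith
  have hn2 : ‖zOf Y1 Y2‖ ≤ 2 := by
    have := norm_sub_norm_le (zOf Y1 Y2) w; linarith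
  have hb : ∀ {X Y : ℕ}, ‖zOf X Y‖ ≤ 2 → |oval X| ≤ 2 ^ 100 ∧ |oval Y| ≤ 2 ^ 100 := by
    intro X Y h
    obtain ⟨ha, hb⟩ := abs_oval_le_of_zOf X Y
    have ha' : |(oval X : ℝ)| ≤ 2 ^ 100 := by rw [hSv] at ha; nlinarith
    have hb' : |(oval Y : ℝ)| ≤ 2 ^ 100 := by rw [hSv] at hb; nlinarith
    exact ⟨by exact_mod_cast ha', by exact_mod_cast hb'⟩
  obtain ⟨bx1, bx2⟩ := hb hn1
  obtain ⟨by1, by2⟩ := hb hn2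
  have hre := oval_cmulRe bx1 bx2 by1 by2
  have him := oval_cmulIm bx1 bx2 by1 by2
  -- the exact product and the rounded one
  set P : ℤ := oval X1 * oval Y1 - oval X2 * oval Y2 with hP
  set Q : ℤ := oval X1 * oval Y2 + oval X2 * oval Y1 with hQ
  have hprod : zOf X1 X2 * zOf Y1 Y2 = ⟨(P : ℝ) / (SCL * SCL), (Q : ℝ) / (SCL * SCL)⟩ := by
    apply Complex.ext <;> simp [zOf, hP, hQ, Complex.mul_re, Complex.mul_im] <;> field_simp
  obtain ⟨hp1, hp2⟩ := Literature.Analysis.ValidatedNumerics.NumericsMP.int_fdiv_bounds P SCL_pos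
  obtain ⟨hq1, hq2⟩ := Literature.Analysis.ValidatedNumerics.NumericsMP.int_fdiv_bounds Q SCL_pos
  have hround : ‖zOf (cmulRe X1 X2 Y1 Y2) (cmulIm X1 X2 Y1 Y2) - zOf X1 X2 * zOf Y1 Y2‖ ≤ 2 / SCL := by
    rw [hprod]
    have e : zOf (cmulRe X1 X2 Y1 Y2) (cmulIm X1 X2 Y1 Y2) - (⟨(P : ℝ) / (SCL * SCL), (Q : ℝ) / (SCL * SCL)⟩ : ℂ) =
        ⟨(((P / SCL : ℤ) : ℝ) - (P : ℝ) / SCL) / SCL, (((Q / SCL : ℤ) : ℝ) - (Q : ℝ) / SCL) / SCL⟩ := by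
      apply Complex.ext
      · simp [zOf, hre]; ring
      · simp [zOf, him]; ring
    rw [e]
    refine (norm_mk_le _ _).trans ?_
    have a1 : |(((P / SCL : ℤ) : ℝ) - (P : ℝ) / SCL) / SCL| ≤ 1 / SCL := by
      rw [abs_div, abs_of_pos hS]
      refine div_le_div_of_nonneg_right ?_ hS.le
      rw [abs_le]; constructor <;> push_cast at hp1 hp2 ⊢ <;> linarith
    have a2 : |(((Q / SCL : ℤ) : ℝ) - (Q : ℝ) / SCL) / SCL| ≤ 1 / SCL := by
      rw [abs_div, abs_of_pos hS]
      refine div_le_div_of_nonneg_right ?_ hS.le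
      rw [abs_le]; constructor <;> push_cast at hq1 hq2 ⊢ <;> linarith
    have : (1 : ℝ) / SCL + 1 / SCL = 2 / SCL := by ring
    linarith
  -- the product of the approximations vs `z w`
  have hmul : ‖zOf X1 X2 * zOf Y1 Y2 - z * w‖ ≤ ε1 + ε2 + ε1 * ε2 := by
    have e : zOf X1 X2 * zOf Y1 Y2 - z * w = (zOf X1 X2 - z) * zOf Y1 Y2 + z * (zOf Y1 Y2 - w) := by ring
    rw [e]
    refine (norm_add_le _ _).trans ?_
    rw [norm_mul, norm_mul, hz, one_mul]
    have hn2' : ‖zOf Y1 Y2‖ ≤ 1 + ε2 := by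
      have := norm_sub_norm_le (zOf Y1 Y2) w; linarith
    have he1' : 0 ≤ ε1 := le_trans (norm_nonneg _) h1
    nlinarith [norm_nonneg (zOf X1 X2 - z), norm_nonneg (zOf Y1 Y2)]
  have e : zOf (cmulRe X1 X2 Y1 Y2) (cmulIm X1 X2 Y1 Y2) - z * w =
      (zOf (cmulRe X1 X2 Y1 Y2) (cmulIm X1 X2 Y1 Y2) - zOf X1 X2 * zOf Y1 Y2) + (zOf X1 X2 * zOf Y1 Y2 - z * w) := by ring
  rw [e]
  exact (norm_add_le _ _).trans (by linarith)

end Summit.RiemannHypothesis.RiemannHypothesis.Theorems.IntegerScrew.Manifest.Fast
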